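import Literature.MathematicalPhysics.QuantumFieldTheory.ConformalBootstrap3D.PointKernelK34Data

/-!
# K34 certificate, kernel block file M7: (M) rows `86 ≤ j < 119` of `mrows`, in 5 row groups

`decide` by kernel reduction (no `native_decide`, no extra axioms) of the block checker of
`PointKernel` on the literal data of `PointKernelK34Data`; soundness is `PCert.mBlockOK_sound`.
Estimated kernel time 144 s (5 theorems).
-/

set_option maxRecDepth 100000
set_option maxHeartbeats 0

namespace Literature.MathematicalPhysics.QuantumFieldTheory.ConformalBootstrap3D.PointKernelK34

open Literature.MathematicalPhysics.QuantumFieldTheory.ConformalBootstrap3D.PointKernel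

/-- (M) rows `[86, 90)` pass the kernel evaluator. [folklore] -/
theorem mBlock_86 : cert.mBlockOK mrows 86 90 = true := by
  decide +kernel

/-- (M) rows `[90, 94)` pass the kernel evaluator. [folklore] -/
theorem mBlock_90 : cert.mBlockOK mrows 90 94 = true := by
  decide +kernel

/-- (M) rows `[94, 99)` pass the kernel evaluator. [folklore] -/
theorem mBlock_94 : cert.mBlockOK mrows 94 99 = true := by
  decide +kernel

/-- (M) rows `[99, 106)` pass the kernel evaluator. [folklore] -/
theorem mBlock_99 : cert.mBlockOK mrows 99 106 = true := by
  decide +kernel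

/-- (M) rows `[106, 119)` pass the kernel evaluator. [folklore] -/
theorem mBlock_106 : cert.mBlockOK mrows 106 119 = true := by
  decide +kernel

end Literature.MathematicalPhysics.QuantumFieldTheory.ConformalBootstrap3D.PointKernelK34
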